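import Summits.CriticalPhenomena.PercolationContinuityZ3.Theorems.PercNearOneGluingNoHeavyLowerTailSahiSlotCell34Facts

/-!
# The cell `(3,4)` in the kernel, III: SOUNDNESS OF THE SEARCH — `checkMask = true` ⟹ `Φ ≥ 0` at every admissible colouring

Support file of the one-cut programme (crux `NoHeavyLowerTail`, stmt-CriticalPhenomena-4575; cell `prim-masterthm`, seat P3, gen 19;
`run/shared/lean/prim/prim-masterthm/prim-masterthm-p3/HIERARCHY.md` §27).  Companion of `…SahiSlotCell34Check` / `…Facts`.

The loop invariants of the checker, innermost first:
* `cellLoop_generic` / **`cellLoop_spec`** — removing ONE cell `y ∉ ↓N_i` from member `i` (36 table updates over the transversals through `y`)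
  takes the invariant `PInv d` to `PInv (addCell d i y)`: the named patterns lose the bit `(i, position of y)`, the others stay, and `Φ` moves
  by `Σ (Ψ(old) − Ψ(new))` over the named transversals = `phiRef d − phiRef (addCell d i y)`;
* **`downLoop_spec`** / **`applyDown_spec`** — giving a point `p` the colour `i` takes `Inv d` to `Inv (addDown d i p)`
  (`addDown d i p = d` with `↓p` or-ed into the `i`-th down-mask; cells already in `↓N_i` are skipped);
* **`colGo_sound`** — the depth-first search over restricted-growth colourings (`Adm nc`: the next colour is at most the number of colours
  used so far) returns `true` only if every admissible colouring of the remaining points reaches a family with `Φ ≥ 0` (`finalD`);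
* `inv_initSt` (all members the whole cube: full patterns, `Φ = 0` by `psiSlow_full`) and **`checkMask_sound`**:
  `checkMask mkCtx m = true → ∀ c, Adm 0 (ptsOf m) c → 0 ≤ phiRef (finalD d0 (ptsOf m) c)`.
HONEST LABEL: soundness of the checker relative to its transversal-form specification `phiRef`; the identification with `patternForm 3 4`
and the undoing of the colour / axis symmetries are the files `…Cell34Ident` / `…Cell34Cover`. [this work]
-/

namespace Summit.CriticalPhenomena.PercolationContinuityZ3.Theorems

namespace SahiSlot34

/-! ## IV. The loop invariants: one cell, one point, the colouring search -/

section Loops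

open Finset

/-- The bit cleared by a cell removal was set. [this work] -/
theorem testBit_patOf_of_pos (d : Fin 4 → ℕ) (i : Fin 4) {y L j : ℕ} (hj : j < 4) (hLj : transCell L j = y)
    (hyd : (d i).testBit y = false) : (patOf d L).testBit (4 * i.val + j) = true := by
  rw [testBit_patOf]
  have h1 : 4 * i.val + j < 16 := by omega
  have h2 : (4 * i.val + j) / 4 % 4 = i.val := by omega
  have h3 : (4 * i.val + j) % 4 = j := by omega
  have hfi : (⟨(4 * i.val + j) / 4 % 4, Nat.mod_lt _ (by norm_num)⟩ : Fin 4) = i := Fin.ext h2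
  simp only [h1, decide_true, Bool.true_and, hfi, h3, hLj, hyd, Bool.not_false]

/-- `1 <<< k = 2^k`. [this work] -/
theorem one_shiftLeft' (k : ℕ) : (1 : ℕ) <<< k = 2 ^ k := by rw [Nat.shiftLeft_eq, one_mul]

/-- GENERIC STEP: running a list of updates with pairwise distinct transversals subtracts `2^b` from each named pattern, leaves the
others alone, and moves `Φ` by the table increments read at the ORIGINAL patterns. [this work] -/
theorem cellLoop_generic (es : List ℕ) (hes : ∀ e ∈ es, e / 16 < 576) (hnd : (es.map (· / 16)).Nodup)
    (pats : Vector ℕ 576) (phi : ℤ) :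
    (∀ (L : ℕ) (hL : L < 576), L ∉ es.map (· / 16) → (cellLoop mkCtx es pats phi).1[L] = pats[L]) ∧
    (∀ e ∈ es, ∀ (h : e / 16 < 576), (cellLoop mkCtx es pats phi).1[e / 16] = pats[e / 16] - 2 ^ (e % 16)) ∧
    (cellLoop mkCtx es pats phi).2 = phi - (es.map fun e => if h : e / 16 < 576 then mkCtx.ct.getD (pats[e / 16] * 16 + e % 16) 0 else 0).sum := by
  induction es generalizing pats phi with
  | nil => simp [cellLoop]
  | cons e es ih =>
    have he : e / 16 < 576 := hes e (by simp)
    have hes' : ∀ e' ∈ es, e' / 16 < 576 := fun e' h => hes e' (by simp [h])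
    rw [List.map_cons, List.nodup_cons] at hnd
    obtain ⟨hnotin, hnd'⟩ := hnd
    have hstep : cellLoop mkCtx (e :: es) pats phi =
        cellLoop mkCtx es (pats.set (e / 16) (pats[e / 16] - (1 <<< (e % 16))) he) (phi - mkCtx.ct.getD (pats[e / 16] * 16 + e % 16) 0) := by
      simp only [cellLoop, he, dif_pos]
    obtain ⟨ih1, ih2, ih3⟩ := ih hes' hnd' (pats.set (e / 16) (pats[e / 16] - (1 <<< (e % 16))) he) (phi - mkCtx.ct.getD (pats[e / 16] * 16 + e % 16) 0)
    rw [hstep]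
    refine ⟨?_, ?_, ?_⟩
    · intro L hL hLn
      rw [List.map_cons, List.mem_cons, not_or] at hLn
      rw [ih1 L hL hLn.2, Vector.getElem_set_ne _ _ (fun h => hLn.1 h.symm)]
    · intro e' he' h'
      rcases List.mem_cons.1 he' with rfl | he'
      · rw [ih1 _ h' hnotin, Vector.getElem_set_self, one_shiftLeft']
      · have hne : e / 16 ≠ e' / 16 := by
          intro h; exact hnotin (by rw [h]; exact List.mem_map.2 ⟨e', he', rfl⟩)
        rw [ih2 e' he' h', Vector.getElem_set_ne _ _ hne]
    · rw [ih3, List.map_cons, List.sum_cons, dif_pos he]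
      have hmap : (es.map fun e' => if h : e' / 16 < 576 then mkCtx.ct.getD ((pats.set (e / 16) (pats[e / 16] - (1 <<< (e % 16))) he)[e' / 16] * 16 + e' % 16) 0 else 0) =
          es.map fun e' => if h : e' / 16 < 576 then mkCtx.ct.getD (pats[e' / 16] * 16 + e' % 16) 0 else 0 := by
        refine List.map_congr_left fun e' he' => ?_
        have hne : e / 16 ≠ e' / 16 := by
          intro h; exact hnotin (by rw [h]; exact List.mem_map.2 ⟨e', he', rfl⟩)
        rw [dif_pos (hes' e' he'), dif_pos (hes' e' he'), Vector.getElem_set_ne _ _ hne]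
      rw [hmap]; ring

/-- **ONE CELL.**  Removing the cell `y ∉ ↓N_i` from member `i` keeps the invariant, the family becoming `addCell d i y`. [this work] -/
theorem cellLoop_spec {d : Fin 4 → ℕ} {pats : Vector ℕ 576} {phi : ℤ} (hI : PInv d pats phi) (i : Fin 4) {y : ℕ} (hy : y < 64)
    (hyd : (d i).testBit y = false) :
    PInv (addCell d i y) (cellLoop mkCtx (mkCtx.ty.getD (4 * y + i) []) pats phi).1
      (cellLoop mkCtx (mkCtx.ty.getD (4 * y + i) []) pats phi).2 := by
  set es := mkCtx.ty.getD (4 * y + i) [] with hes_def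
  have hS : ∀ e ∈ es, e / 16 < 576 ∧ e % 16 = 4 * i.val + e % 16 % 4 ∧ transCell (e / 16) (e % 16 % 4) = y :=
    fun e he => ty_sound hy i.isLt he
  have hes : ∀ e ∈ es, e / 16 < 576 := fun e he => (hS e he).1
  have hnd : (es.map (· / 16)).Nodup := ty_nodup hy i.isLt
  obtain ⟨h1, h2, h3⟩ := cellLoop_generic es hes hnd pats phi
  constructor
  · intro L hL
    by_cases hmem : L ∈ es.map (· / 16)
    · obtain ⟨e, he, heL⟩ := List.mem_map.1 hmem
      obtain ⟨he576, hrow, hcell⟩ := hS e he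
      have hj : e % 16 % 4 < 4 := Nat.mod_lt _ (by norm_num)
      subst heL
      rw [h2 e he hL, hI.pats_eq _ hL, hrow, patOf_addCell_of_mem d i hL hj hcell hyd]
    · rw [h1 L hL hmem, hI.pats_eq L hL, patOf_addCell_of_not_mem d i]
      intro j hj hLj
      exact hmem (List.mem_map.2 ⟨16 * L + (4 * i.val + j), by rw [hes_def, ← hLj]; exact ty_complete hL hj i.isLt, by
        show (16 * L + (4 * i.val + j)) / 16 = L; omega⟩)
  · -- the functional
    rw [h3, hI.phi_eq]
    -- each increment is `Ψ(old pattern) − Ψ(new pattern)` of the named transversal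
    have hterm : ∀ e ∈ es, (if h : e / 16 < 576 then mkCtx.ct.getD (pats[e / 16] * 16 + e % 16) 0 else 0) =
        psiSlow (patOf d (e / 16)) - psiSlow (patOf (addCell d i y) (e / 16)) := by
      intro e he
      obtain ⟨he576, hrow, hcell⟩ := hS e he
      have hj : e % 16 % 4 < 4 := Nat.mod_lt _ (by norm_num)
      rw [dif_pos he576, hI.pats_eq _ he576, hrow,
        ct_getD (patOf_lt d _) (by omega) (testBit_patOf_of_pos d i hj hcell hyd),
        patOf_addCell_of_mem d i he576 hj hcell hyd]
    rw [List.map_congr_left hterm]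
    -- the list sum is the sum over the named transversals; the others do not move
    have hsum : (es.map fun e => psiSlow (patOf d (e / 16)) - psiSlow (patOf (addCell d i y) (e / 16))).sum =
        ∑ L ∈ (es.map (· / 16)).toFinset, (psiSlow (patOf d L) - psiSlow (patOf (addCell d i y) L)) := by
      rw [List.sum_toFinset _ hnd, List.map_map]; rfl
    rw [hsum]
    have hsub : (es.map (· / 16)).toFinset ⊆ range 576 := by
      intro L hL
      rw [List.mem_toFinset] at hL
      obtain ⟨e, he, rfl⟩ := List.mem_map.1 hL
      exact mem_range.2 (hes e he)
    have hT : ∑ L ∈ (es.map (· / 16)).toFinset, (psiSlow (patOf d L) - psiSlow (patOf (addCell d i y) L)) =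
        ∑ L ∈ range 576, (psiSlow (patOf d L) - psiSlow (patOf (addCell d i y) L)) := by
      refine sum_subset hsub (fun L hL hLn => ?_)
      -- transversals off `y` do not move
      rw [List.mem_toFinset] at hLn
      rw [patOf_addCell_of_not_mem d i, sub_self]
      intro j hj hLj
      exact hLn (List.mem_map.2 ⟨16 * L + (4 * i.val + j), by rw [hes_def, ← hLj]; exact ty_complete (mem_range.1 hL) hj i.isLt, by
        show (16 * L + (4 * i.val + j)) / 16 = L; omega⟩)
    rw [hT, sum_sub_distrib]
    unfold phiRef
    ring

end Loops


section Search

open Finset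

/-- Setting an already-set bit changes nothing. [this work] -/
theorem lor_two_pow_of_testBit {x y : ℕ} (h : x.testBit y = true) : x ||| 2 ^ y = x := by
  apply Nat.eq_of_testBit_eq
  intro j
  rw [Nat.testBit_lor, Nat.testBit_two_pow]
  by_cases hj : y = j
  · subst hj; simp [h]
  · simp [hj]

/-- The or of the powers of two of a list of cells. [this work] -/
def bitsOf : List ℕ → ℕ
  | [] => 0
  | y :: ys => 2 ^ y ||| bitsOf ys

/-- Bits of `bitsOf`. [this work] -/
theorem testBit_bitsOf (ys : List ℕ) (c : ℕ) : (bitsOf ys).testBit c = decide (c ∈ ys) := by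
  induction ys with
  | nil => simp [bitsOf]
  | cons y ys ih =>
    rw [bitsOf, Nat.testBit_lor, Nat.testBit_two_pow, ih]
    by_cases h : y = c
    · subst h; simp
    · have h' : ¬ c = y := fun e => h e.symm
      simp [h, h', List.mem_cons]

/-- `bitsOf (downCells p) = downMask p`. [this work] -/
theorem bitsOf_downCells (p : ℕ) : bitsOf (downCells p) = downMask p := by
  apply Nat.eq_of_testBit_eq
  intro c
  rw [testBit_bitsOf, testBit_downMask]
  by_cases hc : c ∈ downCells p
  · have h := mem_downCells.1 hc
    simp [hc, h.1, h.2]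
  · have hc' := hc
    rw [mem_downCells] at hc'
    by_cases h64 : c < 64
    · have : ¬ cle c p = true := fun h => hc' ⟨h64, h⟩
      simp [hc, h64, this]
    · simp [hc, h64]

/-- **ONE POINT, cell by cell.**  Running `downLoop` over distinct cells `ys` with the skip mask agreeing with member `i` on them takes the invariant from `d`
to `d` with the cells of `ys` added to `↓N_i`. [this work] -/
theorem downLoop_spec (i : Fin 4) (ys : List ℕ) (hys : ∀ y ∈ ys, y < 64) (hnd : ys.Nodup) :
    ∀ (d : Fin 4 → ℕ) (dmask : ℕ) (_hdm : ∀ y ∈ ys, dmask.testBit y = (d i).testBit y) (pats : Vector ℕ 576) (phi : ℤ),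
      PInv d pats phi →
      PInv (Function.update d i (d i ||| bitsOf ys)) (downLoop mkCtx i dmask ys pats phi).1 (downLoop mkCtx i dmask ys pats phi).2 := by
  induction ys with
  | nil =>
    intro d dmask _ pats phi hI
    have : Function.update d i (d i ||| bitsOf []) = d := by
      rw [bitsOf, Nat.or_zero]; exact Function.update_eq_self i d
    rw [this]; exact hI
  | cons y ys ih =>
    intro d dmask hdm pats phi hI
    have hy : y < 64 := hys y (by simp)
    have hys' : ∀ y' ∈ ys, y' < 64 := fun y' h => hys y' (by simp [h])
    have hnd' : ys.Nodup := (List.nodup_cons.1 hnd).2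
    have hyn : y ∉ ys := (List.nodup_cons.1 hnd).1
    have hdmy : dmask.testBit y = (d i).testBit y := hdm y (by simp)
    by_cases hbit : dmask.testBit y = true
    · -- skipped: the cell is already in `↓N_i`
      have hstep : downLoop mkCtx i dmask (y :: ys) pats phi = downLoop mkCtx i dmask ys pats phi := by
        simp only [downLoop, hbit, if_true]
      rw [hstep]
      have hdi : (d i).testBit y = true := by rw [← hdmy]; exact hbit
      have hfam : Function.update d i (d i ||| bitsOf (y :: ys)) = Function.update d i (d i ||| bitsOf ys) := by
        rw [bitsOf, ← Nat.lor_assoc, lor_two_pow_of_testBit hdi]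
      rw [hfam]
      exact ih hys' hnd' d dmask (fun y' h => hdm y' (by simp [h])) pats phi hI
    · -- removed now
      have hbit' : dmask.testBit y = false := by simpa using hbit
      have hstep : downLoop mkCtx i dmask (y :: ys) pats phi =
          downLoop mkCtx i dmask ys (cellLoop mkCtx (mkCtx.ty.getD (4 * y + i) []) pats phi).1
            (cellLoop mkCtx (mkCtx.ty.getD (4 * y + i) []) pats phi).2 := by
        simp only [downLoop, hbit', Bool.false_eq_true, if_false]
      rw [hstep]
      have hdi : (d i).testBit y = false := by rw [← hdmy]; exact hbit'
      have hI' := cellLoop_spec hI i hy hdi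
      have hdm' : ∀ y' ∈ ys, dmask.testBit y' = (addCell d i y i).testBit y' := by
        intro y' hy'
        have hne : y ≠ y' := fun h => hyn (h ▸ hy')
        rw [hdm y' (by simp [hy']), addCell, Function.update_self, Nat.testBit_lor, Nat.testBit_two_pow]
        simp [hne]
      have hres := ih hys' hnd' (addCell d i y) dmask hdm' _ _ hI'
      have hfam : Function.update (addCell d i y) i (addCell d i y i ||| bitsOf ys) = Function.update d i (d i ||| bitsOf (y :: ys)) := by
        rw [addCell, Function.update_idem, Function.update_self, bitsOf, Nat.lor_assoc]
      rw [hfam] at hres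
      exact hres

/-- The full search-state invariant: the down-masks, the patterns and `Φ` are those of the family `d`. [this work] -/
structure Inv (d : Fin 4 → ℕ) (s : St) : Prop where
  /-- the colour classes -/
  ds_eq : ∀ i : Fin 4, s.ds[i.val] = d i
  /-- patterns and `Φ` -/
  pinv : PInv d s.pats s.phi

/-- Giving the point `p` the colour `i`: the new family. [this work] -/
def addDown (d : Fin 4 → ℕ) (i : Fin 4) (p : ℕ) : Fin 4 → ℕ := Function.update d i (d i ||| downMask p)

/-- **ONE POINT.**  `applyDown` takes the invariant from `d` to `addDown d i p`. [this work] -/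
theorem applyDown_spec {d : Fin 4 → ℕ} {s : St} (hI : Inv d s) (i : Fin 4) {p : ℕ} (hp : p < 64) :
    Inv (addDown d i p) (applyDown mkCtx i p s) := by
  have hstep : applyDown mkCtx i p s =
      ⟨s.ds.set i (s.ds[i.val] ||| mkCtx.dm.getD p 0) i.isLt, (downLoop mkCtx i s.ds[i.val] (mkCtx.dc.getD p []) s.pats s.phi).1,
        (downLoop mkCtx i s.ds[i.val] (mkCtx.dc.getD p []) s.pats s.phi).2⟩ := by
    simp only [applyDown, i.isLt, dif_pos]
  rw [hstep, dm_getD hp, dc_getD hp]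
  have hP := downLoop_spec i (downCells p) (fun y hy => (mem_downCells.1 hy).1) (nodup_downCells p) d (s.ds[i.val])
    (fun y _ => by rw [hI.ds_eq i]) s.pats s.phi hI.pinv
  rw [bitsOf_downCells] at hP
  constructor
  · intro j
    show (s.ds.set i (s.ds[i.val] ||| downMask p) i.isLt)[j.val] = addDown d i p j
    rw [Vector.getElem_set]
    by_cases hij : i.val = j.val
    · have hij' : i = j := Fin.ext hij
      subst hij'
      simp only [if_true, addDown, Function.update_self, hI.ds_eq i]
    · have hij' : j ≠ i := fun h => hij (by rw [h])
      rw [if_neg hij, addDown, Function.update_of_ne hij', hI.ds_eq j]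
  · exact hP

/-- Admissible (restricted-growth) colourings of a list of points, relative to `nc` colours already in use. [this work] -/
def Adm : ℕ → List ℕ → (ℕ → ℕ) → Prop
  | _, [], _ => True
  | nc, p :: rest, c => c p ≤ nc ∧ c p < 4 ∧ Adm (max nc (c p + 1)) rest c

/-- The family reached by colouring the points of a list. [this work] -/
def finalD : (Fin 4 → ℕ) → List ℕ → (ℕ → ℕ) → (Fin 4 → ℕ)
  | d, [], _ => d
  | d, p :: rest, c => finalD (addDown d ⟨c p % 4, Nat.mod_lt _ (by norm_num)⟩ p) rest c

/-- **THE SEARCH IS SOUND**: if `colGo` returns `true` from a state satisfying the invariant for `d`, then every admissible colouring of the remaining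
points leads to a family with `Φ ≥ 0`. [this work] -/
theorem colGo_sound (pts : List ℕ) (hpts : ∀ p ∈ pts, p < 64) :
    ∀ (nc : ℕ) (d : Fin 4 → ℕ) (s : St) (c : ℕ → ℕ), Inv d s → Adm nc pts c → colGo mkCtx pts nc s = true → 0 ≤ phiRef (finalD d pts c) := by
  induction pts with
  | nil =>
    intro nc d s c hI _ h
    simp only [colGo, decide_eq_true_eq] at h
    rw [finalD, ← hI.pinv.phi_eq]; exact h
  | cons p rest ih =>
    intro nc d s c hI hadm h
    obtain ⟨hle, hlt, hadm'⟩ := hadm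
    have hp : p < 64 := hpts p (by simp)
    simp only [colGo, List.all_eq_true, List.mem_range] at h
    have hcp : c p < min (nc + 1) 4 := by omega
    have hrun := h (c p) hcp
    have hfin : (⟨c p % 4, Nat.mod_lt _ (by norm_num)⟩ : Fin 4) = ⟨c p, hlt⟩ := Fin.ext (Nat.mod_eq_of_lt hlt)
    rw [finalD, hfin]
    exact ih (fun q hq => hpts q (by simp [hq])) (max nc (c p + 1)) _ _ c (applyDown_spec hI ⟨c p, hlt⟩ hp) hadm' hrun

/-- The empty family (all members the whole cube). [this work] -/
def d0 : Fin 4 → ℕ := fun _ => 0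

/-- Its patterns are full. [this work] -/
theorem patOf_d0 (L : ℕ) : patOf d0 L = 65535 := by
  apply Nat.eq_of_testBit_eq
  intro b
  rw [testBit_patOf, show (65535 : ℕ) = 2 ^ 16 - 1 by norm_num, Nat.testBit_two_pow_sub_one]
  simp [d0]

/-- The start state satisfies the invariant for the empty family (`Φ = 0` since `Ψ` vanishes on full patterns). [this work] -/
theorem inv_initSt : Inv d0 initSt := by
  constructor
  · intro i
    show (Vector.replicate 4 0)[i.val] = 0
    rw [Vector.getElem_replicate]
  · constructor
    · intro L hL
      show (Vector.replicate 576 65535)[L] = patOf d0 L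
      rw [Vector.getElem_replicate, patOf_d0]
    · show (0 : ℤ) = phiRef d0
      unfold phiRef
      simp_rw [patOf_d0, psiSlow_full]
      simp

/-- The points of a mask are cells of the cube. [this work] -/
theorem mem_ptsOf {m c : ℕ} : c ∈ ptsOf m ↔ c < 64 ∧ m.testBit c = true := by
  unfold ptsOf
  rw [(List.mergeSort_perm _ _).mem_iff]
  simp [List.mem_filter, List.mem_range]

/-- **`checkMask` IS SOUND**: every admissible 4-colouring of the points of `m` yields a family with `Φ ≥ 0`. [this work] -/
theorem checkMask_sound {m : ℕ} (h : checkMask mkCtx m = true) (c : ℕ → ℕ) (hadm : Adm 0 (ptsOf m) c) :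
    0 ≤ phiRef (finalD d0 (ptsOf m) c) :=
  colGo_sound (ptsOf m) (fun _ hp => (mem_ptsOf.1 hp).1) 0 d0 initSt c inv_initSt hadm h

end Search

end SahiSlot34

end Summit.CriticalPhenomena.PercolationContinuityZ3.Theorems
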